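/-
Copyright: the b2b-balaban T⁴-continuum CRUX team, row NE7b OWNER lineage `t4-ne7b-p1` (gen 109). Project licence.
-/
import Mathlib.MeasureTheory.Measure.Tilted
import Mathlib.Analysis.Convex.Integral
import Mathlib.Analysis.Convex.SpecificFunctions.Basic
import Mathlib.Analysis.SpecialFunctions.Log.Basic
import Mathlib.MeasureTheory.Integral.Bochner.ContinuousLinearMap

/-!
# THE GROWTH LETTER SURVIVES A FLUCTUATION INTEGRAL: if `V(x,y) ≤ V(x₀,y) + ∂ₓV(x₀,y)(x − x₀) + b‖x − x₀‖²` for every fibre point `y`,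
# then `V⁺(x) ≤ V⁺(x₀) + ⟨∂ₓV(x₀,·)⟩_{ν_{x₀}}(x − x₀) + b‖x − x₀‖²` for `V⁺ = −log ∫ e^{−V(·,y)} dμ(y)` — ONE JENSEN STEP under the tilted
# fibre law, no second derivatives (row NE7b, node U5c; residual (R2′) family (2); the upper companion of `…LogConcaveMarginal`,
# feeding `…ConvexWindowTaylorGrowth` ∕ `…ConvexWindowExponentShift`'s growth letter when the exponent difference is itself a marginal)

Cell `pub-balaban`, sub-cell `t4`, spine estimate NE7b (`T4WeightBudget.RelWeightBound`; the cell's OWN estimate — NOT PRINTED in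
[Bałaban 1983–89], NOT PROVED).  Crux-route work under `Spine/NE7b/` by the row's OWNER; NOTHING of Bałaban's is named or asserted;
no `T4Continuum/Support` leaf typed; no `def`; zero `sorry`.  Mathlib only (`Measure.tilted`, `ConvexOn.map_integral_le` = Jensen,
`integral_exp_tilted`, `ContinuousLinearMap.integral_apply` BY NAME).

WHY.  The windowed road carries TWO letters about an exponent through the step: the LOWER one (uniform convexity, modulus `λ` —
`…LogConcaveMarginal`: survives the fluctuation integral by Prékopa ∕ Brascamp–Lieb) and the UPPER one (quadratic growth about the
expansion point, coefficient `b` — the growth letter of `…ConvexWindowExponentShift` ∕ `…ConvexWindowTaylorGrowth`, refuter F464).  The upper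
letter survives too, and more cheaply: by Jensen's inequality under the tilted fibre law `ν_{x₀} = e^{−V(x₀,·)}μ ∕ Z`,
`∫ e^{−V(x,y)} dμ ≥ ∫ e^{−V(x₀,y) − g(y)} dμ = Z·∫ e^{−g} dν_{x₀} ≥ Z·e^{−∫ g dν_{x₀}}` with `g(y) = ∂ₓV(x₀,y)(x − x₀) + b‖x − x₀‖²`, so
`V⁺(x) ≤ V⁺(x₀) + ∫ g dν_{x₀}` and `∫ g dν_{x₀} = D(x − x₀) + b‖x − x₀‖²` with `D = Z⁻¹ • ∫ e^{−V(x₀,y)} • ∂ₓV(x₀,y) dμ` — EXACTLY the derivative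
of `V⁺` at `x₀` displayed by `…LogConcaveMarginalDeriv`.  So the coefficient `b` is INHERITED by the marginal, with the same expansion
point and the marginal's own gradient.

WHAT IS PROVED ([folklore]):
* §1 **`exp_neg_integral_le_integral_exp_neg_tilted`** — Jensen for the tilted law: `μ.tilted f` a probability measure (`e^{f}` integrable,
  `μ ≠ 0`), `g` and `e^{−g}` integrable for it ⟹ `exp(−∫ g d(μ.tilted f)) ≤ ∫ e^{−g} d(μ.tilted f) = (∫ e^{f − g} dμ) ∕ ∫ e^{f} dμ`.
* §2 **`neg_log_integral_le_of_base_growth`** — THE GROWTH LETTER SURVIVES: base `H` a real normed space, fibre `(α, μ)`, `V : H × α → ℝ`,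
  `Vx(x₀,·) : α → (H →L[ℝ] ℝ)`; hypotheses: `e^{−V(x₀,·)}`, `e^{−V(x,·)}` and `e^{−V(x₀,·)} • Vx(x₀,·)` integrable, the sections measurable,
  `0 < Z`, and the fibrewise growth `V(x,y) ≤ V(x₀,y) + Vx(x₀,y)(x − x₀) + b‖x − x₀‖²` for all `y` ⟹
  `−log ∫ e^{−V(x,·)} dμ ≤ −log ∫ e^{−V(x₀,·)} dμ + (Z⁻¹ • ∫ e^{−V(x₀,y)} • Vx(x₀,y) dμ)(x − x₀) + b‖x − x₀‖²`.

NOT HERE (honest): the lower companion and the derivative (`…LogConcaveMarginal`, `…LogConcaveMarginalDeriv` — not imported: this file is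
self-contained over Mathlib); growth letters whose expansion point moves with `y`; which exponent differences of print are marginals
((A3)); anything of Bałaban's.  BY-NAME EFFECT ON THE WALL: NONE.  NE7b NOT PRINTED ∕ NOT PROVED; spine PROVED 0∕9; rung (B)+1 on a FINITE
torus — NOT infinite volume, NOT the mass gap, NOT Clay.
HONEST DEPENDENCY: continuum YM on T⁴ ⇐ BetaPertH ∧ nine spine estimates (0/9 proved); BetaPertH ⇐ (D1) ∧ (D4) ∧ CAP+tail.
-/

set_option autoImplicit false

noncomputable section

open MeasureTheory Real Set Filter
open scoped Topology

namespace Summit.QuantumFields.BalabanUV.T4Continuum.NE7b.LogConcaveMarginalGrowth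

/-! ## §1 Jensen under the tilted law -/

section Jensen

variable {α : Type*} [MeasurableSpace α] {μ : Measure α}

/-- **JENSEN FOR THE TILTED LAW**: if `e^{f}` is `μ`-integrable and `μ ≠ 0` (so `μ.tilted f` is a probability measure) and `g`, `e^{−g}` are
`μ.tilted f`-integrable, then `exp(−∫ g d(μ.tilted f)) ≤ ∫ e^{−g} d(μ.tilted f)`. [folklore] -/
theorem exp_neg_integral_le_integral_exp_neg_tilted [NeZero μ] {f g : α → ℝ} (hf : Integrable (fun y => exp (f y)) μ)
    (hg : Integrable g (μ.tilted f)) (heg : Integrable (fun y => exp (-g y)) (μ.tilted f)) :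
    exp (-∫ y, g y ∂μ.tilted f) ≤ ∫ y, exp (-g y) ∂μ.tilted f := by
  haveI := isProbabilityMeasure_tilted hf
  rw [← integral_neg]
  exact (convexOn_exp.map_integral_le continuous_exp.continuousOn isClosed_univ
    (Eventually.of_forall fun _ => mem_univ _) hg.neg heg)

/-- The tilted integral of `e^{−g}` in terms of `μ`: `∫ e^{−g} d(μ.tilted f) = (∫ e^{f − g} dμ) ∕ ∫ e^{f} dμ`. [folklore] -/
theorem integral_exp_neg_tilted (f g : α → ℝ) :
    ∫ y, exp (-g y) ∂μ.tilted f = (∫ y, exp (f y - g y) ∂μ) / ∫ y, exp (f y) ∂μ := by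
  rw [show (fun y => exp (-g y)) = fun y => exp ((fun y => -g y) y) from rfl, integral_exp_tilted]
  simp only [Pi.add_apply, sub_eq_add_neg]

end Jensen

/-! ## §2 The growth letter of the marginal exponent -/

section Growth

variable {H : Type*} [NormedAddCommGroup H] [NormedSpace ℝ H] {α : Type*} [MeasurableSpace α] {μ : Measure α}

/-- **THE GROWTH LETTER SURVIVES THE FLUCTUATION INTEGRAL.**  Let `V : H × α → ℝ`, base points `x₀, x`, a base derivative `Vx(x₀,·)` at `x₀`
(any family of continuous linear functionals — only the growth inequality below is used), `b : ℝ`.  Assume the sections `V(x₀,·)` and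
`Vx(x₀,·)` are a.e.-strongly measurable, `e^{−V(x₀,·)}`, `e^{−V(x,·)}` and `e^{−V(x₀,·)} • Vx(x₀,·)` are `μ`-integrable, `Z = ∫ e^{−V(x₀,·)} dμ > 0`,
and the FIBREWISE GROWTH `V(x,y) ≤ V(x₀,y) + Vx(x₀,y)(x − x₀) + b‖x − x₀‖²` for every `y`.  Then
`−log ∫ e^{−V(x,·)} dμ ≤ −log Z + (Z⁻¹ • ∫ e^{−V(x₀,y)} • Vx(x₀,y) dμ)(x − x₀) + b‖x − x₀‖²` — the marginal exponent has the same growth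
coefficient `b` about `x₀`, with ITS OWN derivative (the tilted mean of `Vx(x₀,·)`) as the linear term. [folklore] -/
theorem neg_log_integral_le_of_base_growth {V : H × α → ℝ} {Vx : H × α → (H →L[ℝ] ℝ)} {x₀ x : H} {b : ℝ}
    (hVm : AEStronglyMeasurable (fun y => V (x₀, y)) μ) (hVxm : AEStronglyMeasurable (fun y => Vx (x₀, y)) μ)
    (hI₀ : Integrable (fun y => exp (-V (x₀, y))) μ) (hIx : Integrable (fun y => exp (-V (x, y))) μ)
    (hJ : Integrable (fun y => exp (-V (x₀, y)) • Vx (x₀, y)) μ) (hZ : 0 < ∫ y, exp (-V (x₀, y)) ∂μ)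
    (hgrowth : ∀ y, V (x, y) ≤ V (x₀, y) + Vx (x₀, y) (x - x₀) + b * ‖x - x₀‖ ^ 2) :
    -log (∫ y, exp (-V (x, y)) ∂μ) ≤
      -log (∫ y, exp (-V (x₀, y)) ∂μ) +
        (((∫ y, exp (-V (x₀, y)) ∂μ)⁻¹ • ∫ y, exp (-V (x₀, y)) • Vx (x₀, y) ∂μ) (x - x₀) + b * ‖x - x₀‖ ^ 2) := by
  -- the tilted fibre law at `x₀`
  haveI : NeZero μ := ⟨fun h => by simp [h] at hZ⟩
  set f : α → ℝ := fun y => -V (x₀, y) with hf_def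
  have hf : Integrable (fun y => exp (f y)) μ := hI₀
  haveI := isProbabilityMeasure_tilted hf
  -- the growth term `g` and its integrability under the tilted law
  set g : α → ℝ := fun y => Vx (x₀, y) (x - x₀) + b * ‖x - x₀‖ ^ 2 with hg_def
  have hVxν : Integrable (fun y => Vx (x₀, y)) (μ.tilted f) := (integrable_tilted_iff hf _).2 hJ
  have hVxΔ : Integrable (fun y => Vx (x₀, y) (x - x₀)) (μ.tilted f) :=
    (ContinuousLinearMap.apply ℝ ℝ (x - x₀)).integrable_comp hVxν
  have hg : Integrable g (μ.tilted f) := hVxΔ.add (integrable_const _)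
  have hgm : AEStronglyMeasurable g μ :=
    ((ContinuousLinearMap.apply ℝ ℝ (x - x₀)).continuous.comp_aestronglyMeasurable hVxm).add aestronglyMeasurable_const
  -- `e^{f − g} ≤ e^{−V(x,·)}` pointwise, hence integrable, and `e^{−g}` is integrable under the tilted law
  have hle : ∀ y, exp (f y - g y) ≤ exp (-V (x, y)) := fun y => exp_le_exp.2 (by
    simp only [hf_def, hg_def]; linarith [hgrowth y])
  have hfgm : AEStronglyMeasurable (fun y => exp (f y - g y)) μ :=
    continuous_exp.comp_aestronglyMeasurable (hVm.neg.sub hgm)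
  have hIfg : Integrable (fun y => exp (f y - g y)) μ :=
    Integrable.mono' hIx hfgm (Eventually.of_forall fun y => by
      rw [Real.norm_eq_abs, abs_of_pos (exp_pos _)]; exact hle y)
  have heg : Integrable (fun y => exp (-g y)) (μ.tilted f) := by
    refine (integrable_tilted_iff hf _).2 ?_
    refine hIfg.congr (Eventually.of_forall fun y => ?_)
    simp only [smul_eq_mul, sub_eq_add_neg, exp_add]
  -- Jensen and the comparison of the `μ`-integrals
  have hJen := exp_neg_integral_le_integral_exp_neg_tilted hf hg heg
  rw [integral_exp_neg_tilted] at hJen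
  have hmono : ∫ y, exp (f y - g y) ∂μ ≤ ∫ y, exp (-V (x, y)) ∂μ := integral_mono hIfg hIx hle
  have hkey : exp (-∫ y, g y ∂μ.tilted f) ≤ (∫ y, exp (-V (x, y)) ∂μ) / ∫ y, exp (-V (x₀, y)) ∂μ :=
    hJen.trans (div_le_div_of_nonneg_right hmono hZ.le)
  have hZx : 0 < ∫ y, exp (-V (x, y)) ∂μ := by
    have h1 : 0 < (∫ y, exp (-V (x, y)) ∂μ) / ∫ y, exp (-V (x₀, y)) ∂μ := (exp_pos _).trans_le hkey
    exact (div_pos_iff_of_pos_right hZ).1 h1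
  have hlog := log_le_log (exp_pos _) hkey
  rw [log_exp, log_div hZx.ne' hZ.ne'] at hlog
  -- the tilted mean of `g`
  have hgint : ∫ y, g y ∂μ.tilted f =
      (((∫ y, exp (-V (x₀, y)) ∂μ)⁻¹ • ∫ y, exp (-V (x₀, y)) • Vx (x₀, y) ∂μ) (x - x₀) + b * ‖x - x₀‖ ^ 2) := by
    simp only [hg_def]
    rw [integral_add hVxΔ (integrable_const _), integral_const, probReal_univ, one_smul,
      ← ContinuousLinearMap.integral_apply hVxν (x - x₀), integral_tilted]
    congr 2
    rw [← integral_smul]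
    refine integral_congr_ae (Eventually.of_forall fun y => ?_)
    simp only [hf_def, smul_smul, div_eq_inv_mul]
  rw [hgint] at hlog
  linarith

end Growth

end Summit.QuantumFields.BalabanUV.T4Continuum.NE7b.LogConcaveMarginalGrowth
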